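import Summits.CriticalPhenomena.CardyFormulaZ2.Theorems.CardyUSTContinuationKirchhoffExtremalLengthG02Fatou

/-!
# Fatou for the Dirichlet energy along arbitrary meshes: exhaustion of `Ω`
# (`∫∫_Ω ‖∇v‖² ≤ lim 𝓔(h_n)`, [GP19] §4.5)

Support file for `KirchhoffExtremalLength` (route CardyUSTContinuation of `CardyFormulaZ2`, item
stmt-CriticalPhenomena-11234), towards `G02ModulusConvergence` (`…Defs.lean`): the global form
`lintegral_norm_fderiv_sq_le'` of the local Fatou estimate `lintegral_level_le'` of
`…G02Fatou.lean` (arbitrary meshes `δ n → 0⁺`, arbitrary subgraphs `G n` of `ℤ²`), by exhausting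
the bounded open set `Ω` with the increasing finite unions of deep level-`m` dyadic squares —
verbatim the exhaustion of the tree's `SquareTiling.lintegral_norm_fderiv_sq_le`.
-/

noncomputable section

namespace Summit.CriticalPhenomena.CardyFormulaZ2.Theorems

namespace KirchhoffSlope

open Set Metric Filter Topology MeasureTheory
open scoped ENNReal NNReal
open Literature.Probability.LatticeModels Literature.Probability.LatticeModels.SquareTiling

variable {Ω : Set ℂ}

open Classical in
/-- **`∫∫_Ω ‖∇v‖² ≤ lim 𝓔(h_n)` along arbitrary meshes and graphs** (Fatou-type lower
semicontinuity of the Dirichlet energy; [GP19], §4.5). Under the hypotheses of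
`lintegral_level_le'` and for bounded open `Ω`, the whole integral of `‖fderiv ℝ v‖²` over `Ω` is
at most `I`: `Ω` is exhausted by the increasing finite unions of deep level-`m` dyadic squares.
[cite: GeorgakopoulosPanagiotis2019, §4.5] -/
theorem lintegral_norm_fderiv_sq_le' (hΩo : IsOpen Ω) (hΩb : Bornology.IsBounded Ω) {δs : ℕ → ℝ}
    (hδ : ∀ n, 0 < δs n) (hδ0 : Tendsto δs atTop (𝓝 0)) {G : ℕ → SimpleGraph (Site 2)}
    {h : ℕ → Site 2 → ℝ}
    (hedges : ∀ K' ⊆ Ω, IsCompact K' → ∀ᶠ n in atTop, ∀ x : Site 2, meshPoint (δs n) x ∈ K' →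
      ∀ i : Fin 2, s(x, x + (Pi.single i 1 : Site 2)) ∈ (G n).edgeSet)
    {C : ℕ → ℝ≥0∞} (hC : ∀ n, networkEnergy (G n) 1 (h n) ≤ C n)
    {I : ℝ≥0∞} (hI : Tendsto C atTop (𝓝 I)) {v : ℂ → ℝ} (hvc : ContinuousOn (fderiv ℝ v) Ω)
    (hD : ∀ i : Fin 2, TendstoLocallyUniformlyOn
      (fun n w => (h n (nearestSite (δs n) w + Pi.single i 1) - h n (nearestSite (δs n) w)) / δs n)
      (fun w => fderiv ℝ v w (if i = 0 then (1 : ℂ) else Complex.I)) atTop Ω) :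
    ∫⁻ w in Ω, ‖fderiv ℝ v w‖ₑ ^ 2 ≤ I := by
  -- level-`m` data
  set ℓ : ℕ → ℝ := fun m => (2 : ℝ)⁻¹ ^ m with hℓ
  have hℓ0 : ∀ m, 0 < ℓ m := fun m => by positivity
  have hfin : ∀ m, {a : Site 2 | closedBall (meshPoint (ℓ m) a) (10 * ℓ m) ⊆ Ω}.Finite := fun m =>
    (meshVertices_finite hΩb (hℓ0 m)).subset fun a ha => ha (mem_closedBall_self (by positivity))
  set 𝒬 : ℕ → Finset (Site 2) := fun m => (hfin m).toFinset with h𝒬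
  have hmem𝒬 : ∀ m a, a ∈ 𝒬 m ↔ closedBall (meshPoint (ℓ m) a) (10 * ℓ m) ⊆ Ω := fun m a => by
    rw [h𝒬]; exact (hfin m).mem_toFinset
  set Sq : ℕ → Site 2 → Set ℂ := fun m a =>
    Ico (ℓ m * a 0) (ℓ m * (a 0 + 1)) ×ℂ Ico (ℓ m * a 1) (ℓ m * (a 1 + 1)) with hSq
  set K : ℕ → Set ℂ := fun m => ⋃ a ∈ 𝒬 m, Sq m a with hK
  -- points of a square are within `2ℓ` of the corner mesh point
  have hSqdist : ∀ m a w, w ∈ Sq m a → dist w (meshPoint (ℓ m) a) ≤ 2 * ℓ m := by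
    intro m a w hw
    obtain ⟨⟨h0, h0'⟩, ⟨h1, h1'⟩⟩ := hw
    rw [Complex.dist_eq]
    refine (Complex.norm_le_abs_re_add_abs_im _).trans ?_
    simp only [Complex.sub_re, Complex.sub_im, meshPoint_re, meshPoint_im]
    have e0 : |w.re - ℓ m * a 0| ≤ ℓ m := by rw [abs_le]; constructor <;> nlinarith [hℓ0 m]
    have e1 : |w.im - ℓ m * a 1| ≤ ℓ m := by rw [abs_le]; constructor <;> nlinarith [hℓ0 m]
    linarith
  have hℓsucc : ∀ m, ℓ (m + 1) = ℓ m / 2 := fun m => by simp only [hℓ, pow_succ]; ring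
  -- monotonicity of the exhaustion
  have hmono : Monotone K := by
    refine monotone_nat_of_le_succ fun m w hw => ?_
    obtain ⟨a, ha, hw⟩ := mem_iUnion₂.1 hw
    rw [hmem𝒬] at ha
    obtain ⟨hw', hd'⟩ := mem_square_floor (hℓ0 (m + 1)) w
    set a' : Site 2 := ![⌊w.re / ℓ (m + 1)⌋, ⌊w.im / ℓ (m + 1)⌋] with ha'
    refine mem_iUnion₂.2 ⟨a', ?_, hw'⟩
    rw [hmem𝒬]
    intro u hu
    refine ha (mem_closedBall.2 ?_)
    rw [mem_closedBall] at hu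
    have := hSqdist m a w hw
    calc dist u (meshPoint (ℓ m) a) ≤ dist u (meshPoint (ℓ (m + 1)) a') + dist (meshPoint (ℓ (m + 1)) a') w +
          dist w (meshPoint (ℓ m) a) := dist_triangle4 _ _ _ _
      _ ≤ 10 * ℓ (m + 1) + 2 * ℓ (m + 1) + 2 * ℓ m := by gcongr
      _ ≤ 10 * ℓ m := by rw [hℓsucc]; linarith [hℓ0 m]
  -- the squares exhaust `Ω`
  have hcover : Ω ⊆ ⋃ m, K m := by
    intro w hw
    obtain ⟨r, hr, hrΩ⟩ := Metric.isOpen_iff.1 hΩo w hw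
    have ht : Tendsto ℓ atTop (𝓝 0) := tendsto_pow_atTop_nhds_zero_of_lt_one (by norm_num) (by norm_num)
    obtain ⟨m, hm⟩ := (eventually_atTop.1 ((tendsto_order.1 ht).2 _ (show 0 < r / 12 by positivity)))
    have hm' := hm m le_rfl
    obtain ⟨hw', hd'⟩ := mem_square_floor (hℓ0 m) w
    refine mem_iUnion.2 ⟨m, mem_iUnion₂.2 ⟨_, ?_, hw'⟩⟩
    rw [hmem𝒬]
    intro u hu
    refine hrΩ (mem_ball.2 ?_)
    rw [mem_closedBall] at hu
    calc dist u w ≤ dist u (meshPoint (ℓ m) ![⌊w.re / ℓ m⌋, ⌊w.im / ℓ m⌋]) +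
          dist (meshPoint (ℓ m) ![⌊w.re / ℓ m⌋, ⌊w.im / ℓ m⌋]) w := dist_triangle _ _ _
      _ ≤ 10 * ℓ m + 2 * ℓ m := add_le_add hu hd'
      _ < r := by linarith
  -- conclusion
  calc ∫⁻ w in Ω, ‖fderiv ℝ v w‖ₑ ^ 2 ≤ ∫⁻ w in ⋃ m, K m, ‖fderiv ℝ v w‖ₑ ^ 2 := lintegral_mono_set hcover
    _ = ⨆ m, ∫⁻ w in K m, ‖fderiv ℝ v w‖ₑ ^ 2 := setLIntegral_iUnion_of_directed _ hmono.directed_le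
    _ ≤ I := iSup_le fun m => lintegral_level_le' hΩo hδ hδ0 hedges hC hI hvc hD m (𝒬 m)
        (fun a ha => (hmem𝒬 m a).1 ha)

end KirchhoffSlope

end Summit.CriticalPhenomena.CardyFormulaZ2.Theorems
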